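import Summits.BirchSwinnertonDyer.Rank1Residual.X11b.PadicComplexInertiaFixed
import Literature.NumberTheory.LFunctions.DworkRationalitySplittingSeries
import Mathlib.GroupTheory.Archimedean
import HarnessLib

/-!
# X11b @ `p = 3`, S29 K4-C1: the period step — bookkeeping of exponents and the `R₀ˣ`-root

HONEST FRAMING (cell `b2b-bsdres`, run/shared/lean/b2b/bsd-rank1-residual/, verbatim in every
file): the goal of the cell is to DELETE the COMBINATION-SHAPED residual classes of the
Birch–Swinnerton-Dyer formula for ALL analytic-rank `≤ 1` elliptic curves over `ℚ` — assembled
STRICTLY from published theorems — so that the rank-`≤ 1` remainder becomes exactly the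
CONSTRUCTION-SHAPED classes, which are TYPED, NOT attempted. This is not "finishing BSD". Team N8/O2
(X11b at `3`); deal S29 (x11b3-lead GEN 8, OWNERS R9-8/R9-21/R9-30), package K4 (period step),
seat `b2b-bsdres-x11b3-p7` (gen. 5). WORDING OF RECORD (H45, R9-8): S29 RE-EXPRESSES (t) ⟸ (VR).
The structure input "units of `R₀` are algebraic times `N`-th powers" enters as the EXPLICIT
HYPOTHESIS `hRoot` (package K3/T7, to be discharged by another seat); nothing discharges it here;
the node `Three.HsiehDescentAt₃` is UNCHANGED; O2 OPEN / N8 CONSTRUCTION; nothing booked. THEOREMS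
ONLY (no definition, no named fact, no `sorry`); every prime `p`.

## What this file proves (plan `s25/K4-PLAN.md` Step 4 as amended 14:05Z; NOTES 'PERIOD NOTE')

* `zpow_eq_one_of_forall_pow_eq_one` — if `ζ^n = 1` for all `n` in a set `S ⊆ ℕ` then `ζ^z = 1` on
  the subgroup of `ℤ` generated by `S`; `exists_nat_generator` — that subgroup is `gℤ` with `g ∣ n`
  for all `n ∈ S` (`Int.subgroup_cyclic`); hence `pow_generator_eq_of_forall` — if `(Tθ)^n = θ^n`
  for all `n ∈ S` then `(Tθ)^g = θ^g`.
* **`exists_period_root`** — THE PERIOD STEP: if `θ ≠ 0`, `g > 0` and `θ^g ∈ Frac R₀`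
  (`Subfield.closure (unrIntegers p)`), then — GIVEN `hRoot` — there are an algebraic `β ∈ ℚ̄_p` and a
  unit `r ∈ R₀ˣ` with `(β · r⁴)^g = θ^g` (`θ^g = p^{-k}·u`, `u ∈ R₀ˣ` by discreteness
  `R1.exists_norm_eq_zpow_of_mem_fracUnr` and the valuation ring property
  `R1.mem_unrIntegers_of_mem_fracUnr`; `u = α r^{4g}` by `hRoot`; `β^g = α p^{-k}` in the
  algebraically closed `ℚ̄_p`); and `pow_eq_pow_of_dvd` — then `(β r⁴)^n = θ^n` for every `g ∣ n`.
  In K4-C2, `r` is the new `p`-adic period `Ω_p' ∈ R₀ˣ` and `β` is absorbed into the complex period.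

References: [Castella2018] §3 (`R₀`); [Cassels1986] Ch. 4 (units of `\widehat{ℤ_p^{ur}}`); folklore.
-/

noncomputable section

open Literature.NumberTheory.EllipticCurves
open Literature.NumberTheory.LFunctions.Dwork (norm_natCast_p_padicComplex)

namespace Summit.BirchSwinnertonDyer.Rank1Residual.X11b.Three.RangeTransport

variable {p : ℕ} [Fact p.Prime]

/-! ### §1. Exponent bookkeeping -/

/-- If `ζ^n = 1` for every `n ∈ S` then `ζ^z = 1` for every `z` in the subgroup of `ℤ` generated by
`S`. [folklore] -/
theorem zpow_eq_one_of_forall_pow_eq_one {ζ : ℂ_[p]} (hζ : ζ ≠ 0) {S : Set ℕ}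
    (h : ∀ n ∈ S, ζ ^ n = 1) {z : ℤ}
    (hz : z ∈ AddSubgroup.closure ((fun n : ℕ ↦ (n : ℤ)) '' S)) : ζ ^ z = 1 := by
  induction hz using AddSubgroup.closure_induction with
  | mem x hx =>
    obtain ⟨n, hn, rfl⟩ := hx
    rw [zpow_natCast]
    exact h n hn
  | zero => exact zpow_zero _
  | add x y _ _ hx hy => rw [zpow_add₀ hζ, hx, hy, mul_one]
  | neg x _ hx => rw [zpow_neg, hx, inv_one]

/-- The subgroup of `ℤ` generated by `S ⊆ ℕ` is `gℤ` for a natural number `g` dividing every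
element of `S`. [folklore] -/
theorem exists_nat_generator (S : Set ℕ) :
    ∃ g : ℕ, (∀ n ∈ S, g ∣ n) ∧ (g : ℤ) ∈ AddSubgroup.closure ((fun n : ℕ ↦ (n : ℤ)) '' S) := by
  obtain ⟨a, ha⟩ := Int.subgroup_cyclic (AddSubgroup.closure ((fun n : ℕ ↦ (n : ℤ)) '' S))
  refine ⟨a.natAbs, fun n hn ↦ ?_, ?_⟩
  · have hn' : (n : ℤ) ∈ AddSubgroup.closure ({a} : Set ℤ) :=
      ha ▸ AddSubgroup.subset_closure ⟨n, hn, rfl⟩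
    rw [AddSubgroup.mem_closure_singleton] at hn'
    obtain ⟨k, hk⟩ := hn'
    have hdvd : (a.natAbs : ℤ) ∣ (n : ℤ) := by
      rw [Int.natAbs_dvd, ← hk, smul_eq_mul]
      exact Dvd.intro_left k rfl
    exact_mod_cast hdvd
  · rw [ha, AddSubgroup.mem_closure_singleton]
    rcases Int.natAbs_eq a with h | h
    · exact ⟨1, by rw [one_smul, ← h]⟩
    · exact ⟨-1, by rw [neg_one_smul]; exact neg_eq_iff_eq_neg.2 h⟩

/-- **From `(Tθ)^n = θ^n` on `S` to the generator**: if `θ ≠ 0` and `x^n = θ^n` for all `n ∈ S`,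
then `x^g = θ^g` for the generator `g` of `exists_nat_generator`. [folklore] -/
theorem pow_eq_pow_of_forall {θ x : ℂ_[p]} (hθ : θ ≠ 0) {S : Set ℕ} (h : ∀ n ∈ S, x ^ n = θ ^ n)
    {g : ℕ} (hg : (g : ℤ) ∈ AddSubgroup.closure ((fun n : ℕ ↦ (n : ℤ)) '' S)) : x ^ g = θ ^ g := by
  by_cases hx : x = 0
  · -- then `S ⊆ {0}`, so `g = 0`
    have hS : (fun n : ℕ ↦ (n : ℤ)) '' S ⊆ {0} := by
      rintro _ ⟨n, hn, rfl⟩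
      rcases Nat.eq_zero_or_pos n with h0 | hpos
      · simp [h0]
      · exact absurd (by simpa [hx, hpos.ne'] using (h n hn).symm) (pow_ne_zero n hθ)
    have hg0 : (g : ℤ) ∈ (⊥ : AddSubgroup ℤ) := by
      rw [← AddSubgroup.closure_singleton_zero]
      exact AddSubgroup.closure_mono hS hg
    rw [AddSubgroup.mem_bot] at hg0
    have : g = 0 := by exact_mod_cast hg0
    rw [this, pow_zero, pow_zero]
  · have hζ : x / θ ≠ 0 := div_ne_zero hx hθ
    have h1 : ∀ n ∈ S, (x / θ) ^ n = 1 := fun n hn ↦ by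
      rw [div_pow, h n hn, div_self (pow_ne_zero n hθ)]
    have h2 := zpow_eq_one_of_forall_pow_eq_one hζ h1 hg
    rw [zpow_natCast, div_pow, div_eq_one_iff_eq (pow_ne_zero g hθ)] at h2
    exact h2

/-- Powers along multiples: `x^g = θ^g` and `g ∣ n` give `x^n = θ^n`. [folklore] -/
theorem pow_eq_pow_of_dvd {θ x : ℂ_[p]} {g n : ℕ} (h : x ^ g = θ ^ g) (hn : g ∣ n) :
    x ^ n = θ ^ n := by
  obtain ⟨k, rfl⟩ := hn
  rw [pow_mul, pow_mul, h]

/-! ### §2. The period step -/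

/-- **The period step.** GIVEN `hRoot` (every unit of `R₀` is an algebraic number times an `N`-th
power of a unit of `R₀`, all `N ≥ 1`): if `θ ∈ ℂ_pˣ` has `θ^g ∈ Frac R₀` for some `g ≥ 1`, then
`(β · r⁴)^g = θ^g` for an algebraic `β ∈ ℚ̄_p` and a unit `r` of `R₀`. [cite: Castella2018, §3 (p. 9)] -/
theorem exists_period_root
    (hRoot : ∀ N : ℕ, 0 < N → ∀ u : ℂ_[p], u ∈ unrIntegers p → ‖u‖ = 1 →
      ∃ (α : PadicAlgCl p) (r : ℂ_[p]), r ∈ unrIntegers p ∧ ‖r‖ = 1 ∧ u = (α : ℂ_[p]) * r ^ N)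
    {θ : ℂ_[p]} (hθ : θ ≠ 0) {g : ℕ} (hg : 0 < g)
    (hmem : θ ^ g ∈ Subfield.closure (unrIntegers p : Set ℂ_[p])) :
    ∃ (β : PadicAlgCl p) (r : ℂ_[p]), r ∈ unrIntegers p ∧ ‖r‖ = 1 ∧
      ((β : ℂ_[p]) * r ^ 4) ^ g = θ ^ g := by
  have hp : p.Prime := Fact.out
  have hw0 : θ ^ g ≠ 0 := pow_ne_zero _ hθ
  obtain ⟨k, hk⟩ := R1.exists_norm_eq_zpow_of_mem_fracUnr hmem hw0
  have hp0 : (p : ℂ_[p]) ≠ 0 := Nat.cast_ne_zero.2 hp.ne_zero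
  -- the unit `u = θ^g · p^k`
  set u : ℂ_[p] := θ ^ g * (p : ℂ_[p]) ^ k with hu
  have hu1 : ‖u‖ = 1 := by
    rw [hu, norm_mul, norm_zpow, norm_natCast_p_padicComplex, hk, inv_zpow', ← zpow_add₀
      (by exact_mod_cast hp.pos.ne' : (p : ℝ) ≠ 0), add_neg_cancel, zpow_zero]
  have hpR : (p : ℂ_[p]) ∈ Subfield.closure (unrIntegers p : Set ℂ_[p]) :=
    Subfield.subset_closure (natCast_mem (unrIntegers p) p)
  have huF : u ∈ Subfield.closure (unrIntegers p : Set ℂ_[p]) := mul_mem hmem (zpow_mem hpR k)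
  have huR : u ∈ unrIntegers p := R1.mem_unrIntegers_of_mem_fracUnr huF hu1.le
  obtain ⟨α, r, hr, hr1, hαr⟩ := hRoot (4 * g) (by omega) u huR hu1
  -- `β^g = α · p^{-k}` in `ℚ̄_p`
  obtain ⟨β, hβ⟩ := IsAlgClosed.exists_pow_nat_eq (α * ((p : PadicAlgCl p) ^ k)⁻¹) hg
  refine ⟨β, r, hr, hr1, ?_⟩
  have hθg : θ ^ g = u * ((p : ℂ_[p]) ^ k)⁻¹ := by
    rw [hu, mul_assoc, mul_inv_cancel₀ (zpow_ne_zero k hp0), mul_one]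
  have hβ' : ((β : PadicAlgCl p) : ℂ_[p]) ^ g = (α : ℂ_[p]) * ((p : ℂ_[p]) ^ k)⁻¹ := by
    rw [PadicComplex.coe_eq, PadicComplex.coe_eq, ← map_pow, hβ, map_mul, map_inv₀, map_zpow₀,
      map_natCast]
  calc ((β : ℂ_[p]) * r ^ 4) ^ g = ((β : PadicAlgCl p) : ℂ_[p]) ^ g * r ^ (4 * g) := by
        rw [mul_pow, ← pow_mul]
    _ = (α : ℂ_[p]) * ((p : ℂ_[p]) ^ k)⁻¹ * r ^ (4 * g) := by rw [hβ']
    _ = θ ^ g := by rw [hθg, hαr]; ring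

end Summit.BirchSwinnertonDyer.Rank1Residual.X11b.Three.RangeTransport
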